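import Summits.QuantumFields.YangMills.Theorems.BalabanLadderUVSeamRecResponseMomentsPinning
import HarnessLib

/-!
# Crux `UVSeamRec` (stmt-QuantumFields-20043): the v4-F currency implies the v5(α) currency — the plane-resolved femto boundary
# law `FBL6` (∀-exterior, rate `R⁻⁴`) gives the response-moment binder (RM) with ANY `C₁ > 0`

Helper file (`--supports stmt-QuantumFields-20043`) of the stub-helper seat `ym-20043-seam-s2` (lane S-A, gen 2).  Before the
re-cut R86k the ceilings stub was fed by the ∀-exterior law `FBL6 G r a` (`|kerE(plane q x)(η) − p q β| ≤ C₁/depth⁴` for EVERY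
exterior; v4-F's `stub_ceilings` via `stub_collar6`).  The v5(α) binder (RM) replaces «every exterior» by β-uniform joint
exponential moments.  This file records, kernel-checked, that the re-cut is a genuine WEAKENING: the old currency implies the
new one with every `C₁ > 0` (`B = C_law/C₁`), hence (with `…CeilingsProductMoments*`, `…CeilingsKernelForm`) the full chain

  `FBL6` ⇒ (RM) ⇒ (PM) ⇒ (AM) ⇒ `MomentBounds6`.

* `responseMoments_of_uniformLaw` — a uniform centre law `|kerE_{x−(R+1),2R+3}(plane q x)(η) − p q β| ≤ A/R⁴` for all
  exteriors on the guards ⇒ the response-moment bound with any `C₁ > 0`, `B = A/C₁` (pointwise; no separation used).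
* **`responseMoments_of_fbl6`** — `FBL6 G r a` ⇒ the `hRM` hypothesis of p532025 at unit `a`, range `ℓ₁/5`, reference values
  `p` of the law cut off to `0` where no femto cube exists (so that `|p| ≤ P₀` holds for all `β`), any `C₁ > 0`.
* **`responseMomentsOdd6SU2_of_fbl6`** — at `SU(2)`, fundamental representation: `FBL6` at a unit `a ≤ c·uRec` eventually ⇒
  the registered binder `ResponseMomentsOdd6SU2`.

HONEST FRAMING: an implication between two OPEN currencies of a CONDITIONAL chain (the ∀-exterior law is itself suspect as an
engine target, lead g7 evidence #50); nothing of E0′ is proved; not a gap, not Clay.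

References: none beyond the tree.
-/

set_option autoImplicit false

noncomputable section

open MeasureTheory Filter Topology Finset
open Literature.MathematicalPhysics.QuantumFieldTheory (GaugeConfig wilsonMeasure isProbabilityMeasure_wilsonMeasure
  LatticeRep)
open Literature.MathematicalPhysics.QuantumLattice
open Literature.Probability.LatticeModels
open Summit.QuantumFields.YangMills.Cruxes.OSLegsFromFemtoAndGap.DlrCollarTransfer
open Summit.QuantumFields.YangMills.Cruxes.UVSeamRec.TemperedResponse (continuous_kerE_plane abs_kerE_plane_le)

namespace Summit.QuantumFields.YangMills.Cruxes.UVSeamRec.ResponsePinning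

variable {G : Type} [Group G] [TopologicalSpace G] [IsTopologicalGroup G] [CompactSpace G]
  [MeasurableSpace G] [BorelSpace G] (r : LatticeRep G) (a : ℝ → ℝ)

/-! ## §1 A uniform centre law gives the response-moment bound with any `C₁ > 0` -/

/-- **Uniform law ⇒ response moments.**  If for `β ≥ β₁`, `1 ≤ R`, `R·a β ≤ ℓ`, every orientation `q.1 < q.2`, site `x` and
EVERY exterior `η` the radius-`R+1` response obeys `|kerE_{x−(R+1),2R+3}(plane q x)(η) − p q β| ≤ A/R⁴`, then for every
`C₁ > 0` the joint exponential response moments are bounded with `B = A/C₁` — on every odd torus, for every family (no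
separation is needed) and every index set `T`. [folklore] -/
theorem responseMoments_of_uniformLaw {A β₁ ℓ : ℝ} {p : Fin 4 × Fin 4 → ℝ → ℝ}
    (hlaw : ∀ β : ℝ, β₁ ≤ β → ∀ R : ℕ, 1 ≤ R → (R : ℝ) * a β ≤ ℓ →
      ∀ (q : Fin 4 × Fin 4) (x : Fin 4 → ℤ), q.1 < q.2 → ∀ η : LGConfig 4 G,
        |kerE G r β (fun k => x k - (R + 1)) (2 * R + 3) η (plane G r q x) - p q β| ≤ A / (R : ℝ) ^ 4)
    {C₁ : ℝ} (hC₁ : 0 < C₁) :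
    ∀ β : ℝ, β₁ ≤ β → ∀ (L n : ℕ) (q : Fin n → Fin 4 × Fin 4) (x : Fin n → (Fin 4 → ℤ)) (R : ℕ),
      (∀ i, (q i).1 < (q i).2) → 1 ≤ R → (R : ℝ) * a β ≤ ℓ → 4 * R + 8 ≤ L →
      (∀ i j : Fin n, i ≠ j → ∃ k : Fin 4,
        (2 * (R : ℤ) + 4) ≤ |((((x i k - x j k : ℤ) : ZMod (2 * L + 1))).valMinAbs : ℤ)|) →
      ∀ T : Finset (Fin n),
        torusE G r β L (fun U => Real.exp (∑ i ∈ T, (R : ℝ) ^ 4 / C₁ *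
          |kerE G r β (fun k => x i k - (R + 1)) (2 * R + 3) U (plane G r (q i) (x i)) - p (q i) β|)) ≤
          Real.exp (A / C₁ * T.card) := by
  intro β hβ L n q x R hq hR hRa _hRL _hsep T
  have hR0 : (0 : ℝ) < R := by exact_mod_cast (show 0 < R by omega)
  have hpt : ∀ U : LGConfig 4 G, Real.exp (∑ i ∈ T, (R : ℝ) ^ 4 / C₁ *
      |kerE G r β (fun k => x i k - (R + 1)) (2 * R + 3) U (plane G r (q i) (x i)) - p (q i) β|) ≤
        Real.exp (A / C₁ * T.card) := fun U => by
    refine Real.exp_le_exp.2 ?_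
    have hterm : ∀ i ∈ T, (R : ℝ) ^ 4 / C₁ *
        |kerE G r β (fun k => x i k - (R + 1)) (2 * R + 3) U (plane G r (q i) (x i)) - p (q i) β| ≤ A / C₁ := by
      intro i _
      calc (R : ℝ) ^ 4 / C₁ * |kerE G r β (fun k => x i k - (R + 1)) (2 * R + 3) U (plane G r (q i) (x i)) - p (q i) β|
          ≤ (R : ℝ) ^ 4 / C₁ * (A / (R : ℝ) ^ 4) :=
            mul_le_mul_of_nonneg_left (hlaw β hβ R hR hRa (q i) (x i) (hq i) U) (by positivity)
        _ = A / C₁ := by field_simp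
    calc ∑ i ∈ T, (R : ℝ) ^ 4 / C₁ *
          |kerE G r β (fun k => x i k - (R + 1)) (2 * R + 3) U (plane G r (q i) (x i)) - p (q i) β|
        ≤ ∑ i ∈ T, A / C₁ := Finset.sum_le_sum hterm
      _ = A / C₁ * T.card := by rw [Finset.sum_const, nsmul_eq_mul]; ring
  calc _ ≤ torusE G r β L (fun _ => Real.exp (A / C₁ * T.card)) :=
        torusE_mono r β L (Real.continuous_exp.comp (continuous_finsetSum T fun i _ =>
          continuous_const.mul ((continuous_kerE_plane r β _ _ (q i) (x i)).sub continuous_const).abs))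
          continuous_const hpt
    _ = Real.exp (A / C₁ * T.card) := torusE_const r β L _

/-! ## §2 `FBL6` ⇒ (RM) -/

/-- **The plane-resolved femto boundary law implies the response-moment binder, with any `C₁ > 0`.**  `FBL6 G r a` (witnesses
`C_law ≥ 0`, `β₁`, `ℓ₁ > 0`, `p`) ⇒ the `hRM` hypothesis of p532025 `momentBounds6_of_responseMoments` at unit `a` with range
`ℓ₁/5`, threshold `β₁`, `B = C_law/C₁`, and BOUNDED reference values `p' q β := p q β` if `3·a β ≤ ℓ₁` (a femto cube of side `3`
exists, which pins `|p q β| ≤ sup|plane| + C_law/16`) and `0` otherwise (where (RM)'s guard is void anyway).  Mechanism: the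
centre of the radius-`R+1` cube has depth `R+2`; `(2R+3)·a β ≤ 5R·a β ≤ ℓ₁` when `a β ≥ 0` (trivial when `a β < 0`); §1.
[folklore] -/
theorem responseMoments_of_fbl6 (h : FBL6 G r a) {C₁ : ℝ} (hC₁ : 0 < C₁) :
    ∃ (B β₁ ℓ P₀ : ℝ) (p : Fin 4 × Fin 4 → ℝ → ℝ), 0 < ℓ ∧ (∀ q β, |p q β| ≤ P₀) ∧
      ∀ β : ℝ, β₁ ≤ β → ∀ (L n : ℕ) (q : Fin n → Fin 4 × Fin 4) (x : Fin n → (Fin 4 → ℤ)) (R : ℕ),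
        (∀ i, (q i).1 < (q i).2) → 1 ≤ R → (R : ℝ) * a β ≤ ℓ → 4 * R + 8 ≤ L →
        (∀ i j : Fin n, i ≠ j → ∃ k : Fin 4,
          (2 * (R : ℤ) + 4) ≤ |((((x i k - x j k : ℤ) : ZMod (2 * L + 1))).valMinAbs : ℤ)|) →
        ∀ T : Finset (Fin n),
          torusE G r β L (fun U => Real.exp (∑ i ∈ T, (R : ℝ) ^ 4 / C₁ *
            |kerE G r β (fun k => x i k - (R + 1)) (2 * R + 3) U (plane G r (q i) (x i)) - p (q i) β|)) ≤
            Real.exp (B * T.card) := by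
  classical
  obtain ⟨C, β₁, ℓ₁, p, hℓ₁, hC, H⟩ := h
  obtain ⟨CA, hCA⟩ := exists_abs_plane_le (G := G) r
  have hCA0 : 0 ≤ CA := (abs_nonneg _).trans (hCA (0, 1) 0 (fun _ => 1))
  -- cut-off reference values
  let p' : Fin 4 × Fin 4 → ℝ → ℝ := fun q β => if β₁ ≤ β ∧ 3 * a β ≤ ℓ₁ ∧ q.1 < q.2 then p q β else 0
  have hp' : ∀ q β, |p' q β| ≤ CA + C / 16 := by
    intro q β
    by_cases hc : β₁ ≤ β ∧ 3 * a β ≤ ℓ₁ ∧ q.1 < q.2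
    · simp only [p', if_pos hc]
      -- the cube of side `3` around the origin (radius `R₀ + 1`, `R₀ = 0`): centre depth `2`, femto since `3·a β ≤ ℓ₁`
      obtain ⟨R₀, hR₀⟩ : ∃ R₀ : ℕ, R₀ = 0 := ⟨0, rfl⟩
      have hd : 2 ≤ depth (fun k => (0 : Fin 4 → ℤ) k - (R₀ + 1)) (2 * R₀ + 3) 0 := by rw [depth_centred]; omega
      have h3 : ((2 * R₀ + 3 : ℕ) : ℝ) * a β ≤ ℓ₁ := by rw [hR₀]; push_cast; linarith [hc.2.1]
      have hlaw := H β hc.1 (fun k => (0 : Fin 4 → ℤ) k - (R₀ + 1)) (2 * R₀ + 3) h3 (fun _ => 1) q 0 hc.2.2 hd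
      have hker := abs_kerE_plane_le r β (fun k => (0 : Fin 4 → ℤ) k - (R₀ + 1)) (2 * R₀ + 3) q 0 hCA (fun _ => 1)
      rw [depth_centred] at hlaw
      have h16 : C / ((R₀ + 2 : ℕ) : ℝ) ^ 4 = C / 16 := by rw [hR₀]; norm_num
      rw [h16] at hlaw
      have := abs_sub_abs_le_abs_sub (p q β)
        (kerE G r β (fun k => (0 : Fin 4 → ℤ) k - (R₀ + 1)) (2 * R₀ + 3) (fun _ => 1) (plane G r q 0))
      rw [abs_sub_comm] at hlaw
      linarith
    · simp only [p', if_neg hc, abs_zero]; positivity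
  refine ⟨C / C₁, β₁, ℓ₁ / 5, CA + C / 16, p', by positivity, hp', ?_⟩
  -- the uniform law on the guards of (RM), for the cut-off reference values
  refine responseMoments_of_uniformLaw r a (A := C) (β₁ := β₁) (ℓ := ℓ₁ / 5) (p := p') ?_ hC₁
  intro β hβ R hR hRa q x hq η
  have hR1 : (1 : ℝ) ≤ R := by exact_mod_cast hR
  -- the side-(2R+3) cube is femto: `(2R+3)·a β ≤ ℓ₁`
  have hside : ((2 * R + 3 : ℕ) : ℝ) * a β ≤ ℓ₁ := by
    rcases le_or_gt 0 (a β) with ha | ha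
    · push_cast; nlinarith
    · have : ((2 * R + 3 : ℕ) : ℝ) * a β ≤ 0 :=
        mul_nonpos_of_nonneg_of_nonpos (by positivity) ha.le
      linarith
  have h3 : 3 * a β ≤ ℓ₁ := by
    rcases le_or_gt 0 (a β) with ha | ha
    · nlinarith
    · linarith [mul_neg_of_pos_of_neg (by norm_num : (0 : ℝ) < 3) ha]
  have hc : β₁ ≤ β ∧ 3 * a β ≤ ℓ₁ ∧ q.1 < q.2 := ⟨hβ, h3, hq⟩
  have hp'eq : p' q β = p q β := by simp only [p', if_pos hc]
  rw [hp'eq]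
  have hd : 2 ≤ depth (fun k => x k - (R + 1)) (2 * R + 3) x := by rw [depth_centred]; omega
  refine (H β hβ _ _ hside η q x hq hd).trans ?_
  rw [depth_centred]
  have hR0 : (0 : ℝ) < R := by linarith
  refine div_le_div_of_nonneg_left hC (by positivity) ?_
  have h1 : (R : ℝ) ≤ ((R + 2 : ℕ) : ℝ) := by push_cast; linarith
  gcongr

/-! ## §3 At `SU(2)`, fundamental representation: `FBL6` in a window to the unit of record ⇒ the registered binder -/

section Named

open Summit.QuantumFields.YangMills.Cruxes.UVSeamRec.ResponseMomentsDefs (ResponseMomentsOdd6SU2)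

/-- **v4-F's currency implies v5(α)'s.**  For `SU(2)` (Borel structure) in the fundamental representation: the plane-resolved
femto boundary law `FBL6` at some unit `a ≤ c·uRec` eventually (`c > 0`) implies the registered response-moment binder
`ResponseMomentsOdd6SU2` (with `C₁ = 1`). [folklore] -/
theorem responseMomentsOdd6SU2_of_fbl6 {a : ℝ → ℝ} {c : ℝ} (hc : 0 < c)
    (hle : ∀ᶠ β in atTop, a β ≤ c * Transport.uRec β)
    (h : letI : MeasurableSpace (Matrix.specialUnitaryGroup (Fin 2) ℂ) := borel _
      haveI : BorelSpace (Matrix.specialUnitaryGroup (Fin 2) ℂ) := ⟨rfl⟩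
      FBL6 (Matrix.specialUnitaryGroup (Fin 2) ℂ) (fundamentalLatticeRep 2) a) :
    ResponseMomentsOdd6SU2 := by
  letI : MeasurableSpace (Matrix.specialUnitaryGroup (Fin 2) ℂ) := borel _
  haveI : BorelSpace (Matrix.specialUnitaryGroup (Fin 2) ℂ) := ⟨rfl⟩
  obtain ⟨B, β₁, ℓ, P₀, p, hℓ, hp, hRM⟩ := responseMoments_of_fbl6 (fundamentalLatticeRep 2) a h one_pos
  exact ⟨a, c, 1, B, β₁, ℓ, P₀, p, hc, hle, hℓ, one_pos, hp, hRM⟩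

end Named

end Summit.QuantumFields.YangMills.Cruxes.UVSeamRec.ResponsePinning

end
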